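import Literature.MathematicalPhysics.QuantumFieldTheory.Balaban1983to89.Beta.GradedBubbles
import Literature.MathematicalPhysics.QuantumFieldTheory.Balaban1983to89.Beta.BubbleTable

/-!
# `Beta.GradedStencilDictionary` — the realisation of a graded `ℤ⁴` stencil on a finite torus, and the EXACT TORUS LINK:
# the one-loop bubble trace of two realised stencils IS the `ℤ⁴` table `GradedBubbles.bub` fed with the periodised legs

HONEST FRAMING (cell `pub-balaban`, β sub-cell, analysis prover AN3, generation 16; tree target
`Summits/QuantumFields/BalabanUV/Beta/` under the LEAN PLACEMENT RULE 2026-08-19: new cell work lives under `Summits/`, published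
results only under `Literature/`).  Discharging `BetaPertH` would make Bałaban's ultraviolet stability UNCONDITIONAL — a real
constructive-QFT result; it is NOT the continuum limit and NOT the Clay problem.  This file discharges nothing of the kind: it is
ELEMENTARY FINITE LINEAR ALGEBRA (matrix units on `Λ × I`, traces of products of four matrices), kernel-checked.  It is part 1 of 3
of LEAF 2 «REMAINDER-LOG-FREE» of the located «log-free remainder» item of `Beta.PlaquetteStencil` (LEAF 1 = `Beta.GradedBubbles`):
the DICTIONARY between the Literature-side finite stencil matrices (`BubbleTable.elemIns`, the format of `PlaquetteStencil`'s
vertices on a finite periodic lattice `Λ`) and the `ℤ⁴` located-pair stencils `GradedBubbles.Stn` on which the decay calculus runs.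
Value = β-function BOOKKEEPING made rigorous; NOT summit progress.

ABSOLUTE RULE.  No internally-minted statement may enter as a cited fact.  Every hypothesis is either kernel-proved in this package
or a verbatim quotation of a PUBLISHED theorem with page reference.  The manuscript(s) under audit are NOT citable for their own
disputed steps — they are the thing under adjudication; programme-internal (2001/route/tribunal) claims are never citable.  In this
file NOTHING printed is used as a hypothesis and nothing is cited: every statement is proved from the definitions of
`Beta.GradedBubbles` (an3, p194767) and `Beta.BubbleTable` (an2, [folklore] linear algebra), both imported BY NAME and not modified.

WHAT IS PROVED ([folklore] throughout).
* §1 `lift e : ℤ⁴ → Λ`, the additive extension `w ↦ Σ_i w_i • e_i` of a frame `e : Fin 4 → Λ` of an abelian group (the unit vectors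
  of a torus `(ℤ/M)⁴`, or Bałaban's `η`-lattice vectors); additivity, `lift e (±unitVec i) = ±e i`.
* §2 THE REALISATION `real e zr zc V = Σ_{(x,y,m)∈V} elemIns (zr + lift e x) (zc + lift e y) m` of a `ℤ⁴` stencil `V : Stn I` as a
  finite matrix on `Λ × I`, with SEPARATE row/column base points (so that a one-sided translation of the stencil is a change of
  one base point): `real_append/smulS/rowSh/colSh/rowDiff/colDiff` — the `Graded` constructors of `GradedBubbles` §5 are sent to
  sums, scalars, base-point shifts and base-point differences.
* §3 THE TORUS LINK (`trace_real_bubble`): for colour-diagonal translation-invariant propagators `convKernel g`, `convKernel g′`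
  on `Λ` (`BubbleTable` §3) and any two stencils `V, W`,
  `trace (convKernel g · real e z z V · (convKernel g′ · real e (z + lift e w) (z + lift e w) W))
     = GradedBubbles.bub (g ∘ lift e) (g′ ∘ lift e) V W (w)` —
  the second variation bubble of the log-det route (`BubbleTable.bubble_elem` BY NAME, summed over the two lists) IS the `ℤ⁴`
  bubble table of LEAF 1 fed with the PERIODISED legs `g ∘ lift e`; independent of `z`.  (The passage from periodised torus legs to
  the infinite-volume legs with decay — where `GradedBubbles.isO_bub` applies — is the volume limit of the propagators, NOT treated
  here: rows an5/an2 of the cell.)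

NOT PROVED HERE, NOT CLAIMED: anything about Bałaban's propagators, the volume limit, `BetaPertH`, the continuum limit or the Clay
problem.  Parts 2–3 (`WilsonStencilZ4`, `RemainderLogFree`) transcribe `PlaquetteStencil`'s vertices and draw the decay consequence.
-/

namespace Summit.QuantumFields.BalabanUV.Beta.GradedStencilDictionary

open Finset
open scoped BigOperators
open Literature.MathematicalPhysics.QuantumFieldTheory.Balaban1983to89.Beta
open Literature.MathematicalPhysics.QuantumFieldTheory.Balaban1983to89.Beta.DyadicShell (Pt)
open Literature.MathematicalPhysics.QuantumFieldTheory.Balaban1983to89.Beta.BubbleTransfer (unitVec)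
open Literature.MathematicalPhysics.QuantumFieldTheory.Balaban1983to89.Beta.BubbleTable (elemIns elemIns_apply convKernel
  bubble_elem)
open Literature.MathematicalPhysics.QuantumFieldTheory.Balaban1983to89.Beta.GradedBubbles

/-! ## §1 The additive extension of a frame -/

section Lift

variable {Λ : Type*} [AddCommGroup Λ]

/-- `lift e w = Σ_i w_i • e_i`: the additive extension to `ℤ⁴` of a frame `e : Fin 4 → Λ`.  A definition asserting nothing.
[folklore] -/
def lift (e : Fin 4 → Λ) (w : Pt) : Λ := ∑ i, w i • e i

/-- additivity. [folklore] -/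
theorem lift_add (e : Fin 4 → Λ) (a b : Pt) : lift e (a + b) = lift e a + lift e b := by
  simp only [lift, Pi.add_apply, add_zsmul, Finset.sum_add_distrib]

/-- `lift e 0 = 0`. [folklore] -/
@[simp] theorem lift_zero (e : Fin 4 → Λ) : lift e 0 = 0 := by
  simp [lift]

/-- `lift e (−a) = −lift e a`. [folklore] -/
theorem lift_neg (e : Fin 4 → Λ) (a : Pt) : lift e (-a) = -lift e a := by
  simp only [lift, Pi.neg_apply, neg_zsmul, Finset.sum_neg_distrib]

/-- `lift e (a − b) = lift e a − lift e b`. [folklore] -/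
theorem lift_sub (e : Fin 4 → Λ) (a b : Pt) : lift e (a - b) = lift e a - lift e b := by
  rw [sub_eq_add_neg, lift_add, lift_neg, ← sub_eq_add_neg]

/-- the frame vectors: `lift e (unitVec i) = e i`. [folklore] -/
@[simp] theorem lift_unitVec (e : Fin 4 → Λ) (i : Fin 4) : lift e (unitVec i) = e i := by
  unfold lift unitVec
  rw [Finset.sum_eq_single i]
  · simp
  · intro j _ hj; simp [hj]
  · intro h; exact absurd (Finset.mem_univ i) h

/-- `lift e (−unitVec i) = −e i`. [folklore] -/
@[simp] theorem lift_neg_unitVec (e : Fin 4 → Λ) (i : Fin 4) : lift e (-unitVec i) = -e i := by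
  rw [lift_neg, lift_unitVec]

end Lift

/-! ## §2 The realisation of a `ℤ⁴` stencil on `Λ × I` and its homomorphism laws -/

section Real

variable {Λ : Type*} [DecidableEq Λ] [AddCommGroup Λ] {I : Type*}

/-- **THE REALISATION** of a `ℤ⁴` located-pair stencil on the lattice `Λ` with row base point `zr` and column base point `zc`:
`real e zr zc V = Σ_{(x,y,m)∈V} elemIns (zr + lift e x) (zc + lift e y) m` (list recursion; duplicates add).  A definition
asserting nothing. [folklore] -/
def real (e : Fin 4 → Λ) (zr zc : Λ) : Stn I → Matrix (Λ × I) (Λ × I) ℝ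
  | [] => 0
  | p :: V => elemIns (zr + lift e p.x) (zc + lift e p.y) p.m + real e zr zc V

variable (e : Fin 4 → Λ)

/-- recursion, empty list. [folklore] -/
@[simp] theorem real_nil (zr zc : Λ) : real e zr zc ([] : Stn I) = 0 := rfl

/-- recursion, cons. [folklore] -/
@[simp] theorem real_cons (zr zc : Λ) (p : LP I) (V : Stn I) :
    real e zr zc (p :: V) = elemIns (zr + lift e p.x) (zc + lift e p.y) p.m + real e zr zc V := rfl

/-- a singleton. [folklore] -/
theorem real_singleton (zr zc : Λ) (p : LP I) : real e zr zc [p] = elemIns (zr + lift e p.x) (zc + lift e p.y) p.m := by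
  simp

/-- concatenation ↦ sum. [folklore] -/
theorem real_append (zr zc : Λ) (V W : Stn I) : real e zr zc (V ++ W) = real e zr zc V + real e zr zc W := by
  induction V with
  | nil => simp
  | cons p V ih => simp [ih, add_assoc]

omit [AddCommGroup Λ] in
/-- `elemIns` is linear in the internal matrix. [folklore] -/
theorem elemIns_smul (x y : Λ) (c : ℝ) (m : Matrix I I ℝ) : elemIns x y (c • m) = c • elemIns x y m := by
  ext ⟨u, a⟩ ⟨v, b⟩
  simp only [elemIns_apply, Matrix.smul_apply, smul_eq_mul]
  split_ifs <;> simp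

/-- scalar ↦ scalar. [folklore] -/
theorem real_smulS (zr zc : Λ) (c : ℝ) (V : Stn I) : real e zr zc (smulS c V) = c • real e zr zc V := by
  induction V with
  | nil => simp [smulS]
  | cons p V ih =>
    have h : smulS c (p :: V) = ⟨p.x, p.y, c • p.m⟩ :: smulS c V := rfl
    rw [h, real_cons, real_cons, ih, elemIns_smul, smul_add]

/-- row translation ↦ row base point. [folklore] -/
theorem real_rowSh (zr zc : Λ) (a : Pt) (V : Stn I) : real e zr zc (rowSh a V) = real e (zr + lift e a) zc V := by
  induction V with
  | nil => simp [rowSh]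
  | cons p V ih =>
    have h : rowSh a (p :: V) = ⟨p.x + a, p.y, p.m⟩ :: rowSh a V := rfl
    rw [h, real_cons, real_cons, ih, lift_add]
    congr 2; abel

/-- column translation ↦ column base point. [folklore] -/
theorem real_colSh (zr zc : Λ) (a : Pt) (V : Stn I) : real e zr zc (colSh a V) = real e zr (zc + lift e a) V := by
  induction V with
  | nil => simp [colSh]
  | cons p V ih =>
    have h : colSh a (p :: V) = ⟨p.x, p.y + a, p.m⟩ :: colSh a V := rfl
    rw [h, real_cons, real_cons, ih, lift_add]
    congr 2; abel

/-- row difference ↦ difference of row base points. [folklore] -/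
theorem real_rowDiff (zr zc : Λ) (a : Pt) (V : Stn I) :
    real e zr zc (rowDiff a V) = real e (zr + lift e a) zc V - real e zr zc V := by
  rw [rowDiff, real_append, real_rowSh, real_smulS, neg_one_smul, sub_eq_add_neg]

/-- column difference ↦ difference of column base points. [folklore] -/
theorem real_colDiff (zr zc : Λ) (a : Pt) (V : Stn I) :
    real e zr zc (colDiff a V) = real e zr (zc + lift e a) V - real e zr zc V := by
  rw [colDiff, real_append, real_colSh, real_smulS, neg_one_smul, sub_eq_add_neg]

end Real

/-! ## §3 The torus link: the bubble trace of two realised stencils is the `ℤ⁴` table `bub` with periodised legs -/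

section PerLeg

variable {Λ : Type*} [AddCommGroup Λ] (e : Fin 4 → Λ)

/-- The PERIODISED LEG: a kernel `g` on `Λ` read on `ℤ⁴` through the frame, as a constant `(L,k)`-family.  A definition asserting
nothing. [folklore] -/
def perLeg (g : Λ → ℝ) : Fam := fun _ _ v => g (lift e v)

/-- its value. [folklore] -/
@[simp] theorem perLeg_apply (g : Λ → ℝ) (L k : ℕ) (v : Pt) : perLeg e g L k v = g (lift e v) := rfl

end PerLeg

section Link

variable {Λ : Type*} [Fintype Λ] [DecidableEq Λ] [AddCommGroup Λ] {I : Type*} [Fintype I] [DecidableEq I]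
variable (e : Fin 4 → Λ)

/-- ONE located pair against ONE located pair: `BubbleTable.bubble_elem` read through the frame is `GradedBubbles.term`.
[folklore] -/
theorem trace_elem_elem (g g' : Λ → ℝ) (z : Λ) (w : Pt) (p q : LP I) (L k : ℕ) :
    Matrix.trace (convKernel g * elemIns (z + lift e p.x) (z + lift e p.y) p.m *
        (convKernel g' * elemIns (z + lift e w + lift e q.x) (z + lift e w + lift e q.y) q.m)) =
      term (perLeg e g) (perLeg e g') p q L k w := by
  rw [bubble_elem, term, perLeg_apply, perLeg_apply]
  have h1 : z + lift e p.x - (z + lift e w + lift e q.y) = lift e (p.x - q.y - w) := by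
    rw [lift_sub, lift_sub]; abel
  have h2 : z + lift e w + lift e q.x - (z + lift e p.y) = lift e (w + (q.x - p.y)) := by
    rw [lift_add, lift_sub]; abel
  rw [h1, h2]; ring

/-- ONE located pair against a stencil: the row sum `GradedBubbles.bubRow`. [folklore] -/
theorem trace_elem_real (g g' : Λ → ℝ) (z : Λ) (w : Pt) (p : LP I) (W : Stn I) (L k : ℕ) :
    Matrix.trace (convKernel g * elemIns (z + lift e p.x) (z + lift e p.y) p.m *
        (convKernel g' * real e (z + lift e w) (z + lift e w) W)) =
      bubRow (perLeg e g) (perLeg e g') p W L k w := by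
  induction W with
  | nil => simp [bubRow]
  | cons q W ih =>
    rw [real_cons, Matrix.mul_add, Matrix.mul_add, Matrix.trace_add, ih, trace_elem_elem e g g' z w p q L k]
    simp [bubRow]

/-- **THE TORUS LINK**: the one-loop bubble trace of the two realised stencils (the first at the background site `z`, the second at
`z + lift e w`) through colour-diagonal translation-invariant propagators on `Λ` IS the `ℤ⁴` bubble table of `GradedBubbles` fed with
the periodised legs; nothing depends on `z`. [folklore] -/
theorem trace_real_bubble (g g' : Λ → ℝ) (z : Λ) (w : Pt) (V W : Stn I) (L k : ℕ) :
    Matrix.trace (convKernel g * real e z z V * (convKernel g' * real e (z + lift e w) (z + lift e w) W)) =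
      bub (perLeg e g) (perLeg e g') V W L k w := by
  induction V with
  | nil => simp [bub]
  | cons p V ih =>
    rw [real_cons, Matrix.mul_add, Matrix.add_mul, Matrix.trace_add, ih, trace_elem_real e g g' z w p W L k]
    simp [bub]

end Link

end Summit.QuantumFields.BalabanUV.Beta.GradedStencilDictionary
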